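import Summits.CriticalPhenomena.PercolationContinuityZ3.Theorems.PercNearOneGluingNoHeavyQuantArmEntropicBound
import Summits.CriticalPhenomena.PercolationContinuityZ3.Theorems.PercNearOneGluingNoHeavyQuantPowerLawInputs
import Mathlib.Analysis.SpecialFunctions.Pow.Asymptotics
import HarnessLib
import HarnessLib.Audit.Tags

/-!
# PAPER-2 track, ARM-3 (gen 2): the near-critical HALVING input (EGPS 2025's renormalisation step) TYPED, and its kernel
# dictionary — halving at the correlation scale + a subcritical susceptibility bound ⇒ the SHARP one-arm exponent `(2−g)/ν`
# (in mean field: Kozma–Nachmias's `2`)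

builds on p205010 (kernel theorem, internal audit signed; external expert review pending).
Status sentence for p205010: "θ(p_c) = 0 on ℤ^d, all d ≥ 2 — kernel-verified (Lean 4/Mathlib, standard axioms); internal
adversarial audit SIGNED 2026-08-20 04:29Z; external expert review pending."

Seat `prim-quant-arm-3` gen 2 (memo `run/shared/lean/prim/quant/prim-quant-arm-3/POWERLAW-SURVEY.md` §4(C), §9–§10).  Route (C2) of the
survey: Dewan–Muirhead's mechanism `η₁ ≥ (2−γ)/ν`.  The tree has it as `Quant.oneArmPolyDecayAtCritical_of_subcriticalArmDecay` (p243001) from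
an EXPONENTIAL-decay arm input, which costs a logarithm in the choice of scale and yields every exponent `c < (2−g)/ν` but not the
endpoint.  van Engelenburg–Garban–Panis–Severo (arXiv:2510.21595, §1.2 and §3) obtain the endpoint — for spread-out percolation in `d > 6`,
the sharp `θ_n(p_c) ≍ n^{−2}` of Kozma–Nachmias — from a different near-critical input: at `p' = p_c − K n^{−2}` one has
`θ_n(p') ≤ (1/8) θ_{n/2}(p_c)` (their (1.25), from the Duminil-Copin–Panis sharp-length bound `φ_{p'}(Λ_{n/2}) ≤ 1/8` and a BK
decomposition), which together with `χ(p') ≲ (p_c − p')^{−1}` and the entropic bound gives the renormalisation inequality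
`θ_n(p_c) ≤ (1/8) θ_{n/2}(p_c) + K₂ n^{−1} √θ_n(p_c)` and hence `θ_n(p_c) ≤ A n^{−2}` by induction over dyadic scales.

This file TYPES the halving input with a general correlation-length exponent `ν` — `Quant.NearCriticalArmHalving d A ν κ n₀`: for every
`n ≥ n₀` there is a subcritical `q ∈ [p_c/2, p_c)` within `A n^{−1/ν}` of `p_c` with `π_q(n) ≤ κ · π_{p_c}(⌈n/2⌉)` — and proves the
kernel dictionary entry

* `Quant.oneArmPolyDecayAtCritical_of_armHalving`: **`ChiSubcritPowerBound d M g δ₀` (`g < 2`) + `NearCriticalArmHalving d A ν κ n₀` with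
  `2κ·2^θ < 1`, `θ = (2−g)/ν` ⟹ `∃ C, OneArmPolyDecayAtCritical d θ C`** — the SHARP exponent `θ = (2−g)/ν`, no `ε`-loss.  Proof: the
  tree's one-arm entropic inequality at `p_c` (`Quant.oneArm_criticalProb_le_entropic_chi`, p242696, the linearised form with factor `2`)
  gives `π_{p_c}(n) ≤ 2κ π_{p_c}(⌈n/2⌉) + K₀ n^{−θ}` for large `n`, and a strong induction on `n` closes at `C = max(N₀^θ, K₀/(1 − 2κ2^θ))`.
  With the linearised entropic bound the smallness `2κ·2^θ < 1` is needed (EGPS's `κ = 1/8` at `θ = 2` is the borderline `2κ2^θ = 1`;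
  their square-root form of the entropic bound closes for every `κ·2^θ < 1`; any `κ < 1/8` works here, and `κ` is adjustable in their
  setting by enlarging `K`);
* `Quant.oneArmPolyDecayAtCritical_two_of_armHalving`: the mean-field row — **`TriangleCondition d` (⇒ `γ = 1`, Aizenman–Newman, kernel) +
  `NearCriticalArmHalving d A (1/2) κ n₀` with `κ < 1/8` ⟹ `∃ C, OneArmPolyDecayAtCritical d 2 C`**, i.e. `π_{p_c}(n) ≤ C n^{−2}`:
  Kozma–Nachmias's exponent from EGPS's renormalisation input, as a kernel implication (an alternative to discharging
  `KozmaNachmias2011_thm2`).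

Honest status: `NearCriticalArmHalving` is OPEN for `3 ≤ d ≤ 6` with any `ν` (no correlation-length upper bound of power type is in print
there; numerically `ν ≈ 0.88 / 0.69 / 0.57` in `d = 3/4/5`, orientation only) and is a THEOREM in print only for spread-out percolation in
`d > 6` (EGPS 2025, (1.25), via Duminil-Copin–Panis 2025) — not for the nearest-neighbour model of this tree, where for `d ≥ 11` it would
follow from the plateau/sharp-length estimates of Hutchcroft–Michta–Slade (which rely on Chatterjee–Hanson and Kozma–Nachmias).  Typed as a
`@[conjecture]` schema, never as a Literature fact.  Nothing in this file is a rate for `d = 3`.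
-/

noncomputable section

namespace Summit.CriticalPhenomena.PercolationContinuityZ3.Theorems.Quant

open MeasureTheory Filter Topology Literature.Probability.Percolation Literature.Probability.LatticeModels
open Literature.Barriers.CriticalPhenomena

variable {d : ℕ}

/-- **(C2′-input) Near-critical arm HALVING at the correlation scale, exponent `ν`, factor `κ`:** for every `n ≥ n₀` there is a
subcritical parameter `q` with `p_c/2 ≤ q < p_c` and `p_c − q ≤ A n^{−1/ν}` (i.e. `n ≳ ξ(q)` when `ξ(q) ≍ (p_c−q)^{−ν}`) at which the
one-arm probability at scale `n` is at most `κ` times the CRITICAL one-arm probability at scale `⌈n/2⌉`: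
`π_q(n) ≤ κ · π_{p_c}(⌈n/2⌉)`.  EGPS's input (1.25) is the case `ν = 1/2`, `κ = 1/8`, `q = p_c − K₁ n^{−2}` (spread-out, `d > 6`); it follows
from a sharp-length bound `φ_q(Λ_{n/2}) ≤ κ` by the BK decomposition `θ_n(q) ≤ φ_q(Λ_{n/2}) θ_{n/2}(q) ≤ φ_q(Λ_{n/2}) θ_{n/2}(p_c)`.  OPEN for
`3 ≤ d ≤ 6`; typed, not asserted.  builds on p205010 (kernel theorem, internal audit signed; external expert review pending).
[cite: VanEngelenburgGarbanPanisSevero2025, §1.2 eq. (1.25) and §3 (θ_n(p') ≤ φ_{p'}(Λ_{n/2−L}) θ_{n/2}(p_c) ≤ θ_{n/2}(p_c)/8)]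
[cite: DewanMuirhead2022, §2 (choice of p' with P_{p'}[A₁(R)] ≤ ½ P_{p_c}[A₁(R)])] -/
@[conjecture] def NearCriticalArmHalving (d : ℕ) (A ν κ : ℝ) (n₀ : ℕ) : Prop :=
  ∀ n : ℕ, n₀ ≤ n → ∃ q : unitInterval, (criticalProbI d : ℝ) / 2 ≤ q ∧ (q : ℝ) < criticalProbI d ∧
    (criticalProbI d : ℝ) - q ≤ A * (n : ℝ) ^ (-(1 / ν)) ∧
    oneArmProb d q n ≤ κ * oneArmProb d (criticalProbI d) ((n + 1) / 2)

/-- `⌈n/2⌉ = (n+1)/2` is at least `n/2` (as reals). [folklore] -/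
theorem half_le_cast_succ_div_two (n : ℕ) : (n : ℝ) / 2 ≤ (((n + 1) / 2 : ℕ) : ℝ) := by
  have h : n ≤ 2 * ((n + 1) / 2) := by omega
  have h' : (n : ℝ) ≤ 2 * (((n + 1) / 2 : ℕ) : ℝ) := by exact_mod_cast h
  linarith

/-- **THE HALVING DICTIONARY (route C2′, sharp exponent).**  Let `d ≥ 2`, `g < 2`, `ν > 0`, `θ = (2−g)/ν`, `0 ≤ κ` with `2κ·2^θ < 1`,
`0 ≤ A`.  If `χ(q) ≤ M (p_c − q)^{−g}` on `(p_c − δ₀, p_c)` (`ChiSubcritPowerBound d M g δ₀`, `δ₀ > 0`) and the halving input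
`NearCriticalArmHalving d A ν κ n₀` holds, then `π_{p_c}(n) ≤ C n^{−θ}` for all `n ≥ 1`: `∃ C, OneArmPolyDecayAtCritical d ((2−g)/ν) C`.
Proof: for large `n`, the entropic inequality `π_{p_c}(n) ≤ 2π_q(n) + (8d/(q(1−p_c)²))(p_c−q)²χ(q)` at the halving parameter `q = q_n` gives
`π_{p_c}(n) ≤ 2κ π_{p_c}(⌈n/2⌉) + K₀ n^{−θ}` with `K₀ = (16d/(p_c(1−p_c)²)) M A^{2−g}`; strong induction on `n`.  CONDITIONAL: both inputs
are open for `3 ≤ d ≤ 6`.  In exponent language `η₁ ≥ (2−γ)/ν` with equality of exponents attained by the bound (Dewan–Muirhead's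
Thm. 1.10 mechanism; EGPS's renormalisation inequality).
[cite: DewanMuirhead2022, Thm. 1.10 and §2] [cite: VanEngelenburgGarbanPanisSevero2025, §3 (proof of the upper bound in Thm. 1.1: the renormalisation inequality and the dyadic induction)]
[cite: Hutchcroft2022Triangle, Thm. 4.1 (the entropic bound)] -/
theorem oneArmPolyDecayAtCritical_of_armHalving (hd : 2 ≤ d) {M g δ₀ A ν κ : ℝ} {n₀ : ℕ}
    (hg : g < 2) (hν : 0 < ν) (hδ₀ : 0 < δ₀) (hA : 0 ≤ A) (hκ : 0 ≤ κ)
    (hsmall : 2 * κ * (2 : ℝ) ^ ((2 - g) / ν) < 1)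
    (hχ : ChiSubcritPowerBound d M g δ₀) (hH : NearCriticalArmHalving d A ν κ n₀) :
    ∃ C : ℝ, OneArmPolyDecayAtCritical d ((2 - g) / ν) C := by
  have hd1 : 1 ≤ d := by omega
  set pc : ℝ := (criticalProbI d : ℝ) with hpcdef
  have hpc0 : 0 < pc := by rw [hpcdef, coe_criticalProbI]; exact criticalProb_zd_pos d hd1
  have hpc1 : pc < 1 := by rw [hpcdef, coe_criticalProbI]; exact criticalProb_zd_lt_one hd
  have hdR : (0 : ℝ) < d := by exact_mod_cast (show 0 < d by omega)
  set θ : ℝ := (2 - g) / ν with hθ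
  have hθ0 : 0 < θ := div_pos (by linarith) hν
  have h2θ : (1 : ℝ) ≤ (2 : ℝ) ^ θ := Real.one_le_rpow (by norm_num) hθ0.le
  have hM0 : 0 < M := chiSubcritPowerBound_const_pos hd hδ₀ hχ
  -- the scale beyond which the halving parameter lies in the susceptibility window
  obtain ⟨n₁, hn₁⟩ : ∃ n₁ : ℕ, ∀ n : ℕ, n₁ ≤ n → A * (n : ℝ) ^ (-(1 / ν)) < δ₀ := by
    have ht : Tendsto (fun n : ℕ => A * (n : ℝ) ^ (-(1 / ν))) atTop (𝓝 (A * 0)) :=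
      ((tendsto_rpow_neg_atTop (one_div_pos.2 hν)).comp tendsto_natCast_atTop_atTop).const_mul A
    rw [mul_zero] at ht
    exact Filter.eventually_atTop.1 ((tendsto_order.1 ht).2 δ₀ hδ₀)
  -- constants
  set K₁ : ℝ := 16 * d / (pc * (1 - pc) ^ 2) with hK₁
  have hden : 0 < pc * (1 - pc) ^ 2 := mul_pos hpc0 (pow_pos (by linarith) 2)
  have hK₁0 : 0 < K₁ := by rw [hK₁]; positivity
  set K₀ : ℝ := K₁ * M * A ^ (2 - g) with hK₀
  have hK₀0 : 0 ≤ K₀ := by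
    rw [hK₀]; exact mul_nonneg (mul_nonneg hK₁0.le hM0.le) (Real.rpow_nonneg hA _)
  -- notation for the critical one-arm probability
  have hπ : ∀ n : ℕ, oneArmProb d (criticalProbI d) n =
      (bondPercolation (zdGraph d) (criticalProbI d)).real (siteToBoundary d n) := fun n => rfl
  -- ONE STEP: `π_{p_c}(n) ≤ 2κ π_{p_c}(⌈n/2⌉) + K₀ n^{-θ}` for `n ≥ max n₀ n₁`, `n ≥ 1`
  have step : ∀ n : ℕ, n₀ ≤ n → n₁ ≤ n → 1 ≤ n →
      oneArmProb d (criticalProbI d) n ≤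
        2 * κ * oneArmProb d (criticalProbI d) ((n + 1) / 2) + K₀ * (n : ℝ) ^ (-θ) := by
    intro n hn0 hn1 hn
    obtain ⟨q, hq1, hq2, hqA, hhalf⟩ := hH n hn0
    have hnR : (0 : ℝ) < n := by exact_mod_cast hn
    have hq0 : 0 < (q : ℝ) := by linarith
    set s : ℝ := pc - q with hs
    have hs0 : 0 < s := by rw [hs]; linarith
    have hsδ : s < δ₀ := lt_of_le_of_lt hqA (hn₁ n hn1)
    -- the entropic inequality at `q`
    have hE := oneArm_criticalProb_le_entropic_chi hd n q hq0 hq2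
    -- `χ(q) ≤ M s^{-g}`
    have hχq : chi d q ≤ M * s ^ (-g) := hχ q (by rw [hs] at hsδ; linarith) hq2
    -- the prefactor `8d/(q(1-p_c)²) ≤ K₁`
    have hpre : 8 * d / ((q : ℝ) * (1 - pc) ^ 2) ≤ K₁ := by
      rw [hK₁, div_le_div_iff₀ (mul_pos hq0 (pow_pos (by linarith) 2)) hden]
      have h1pc : 0 < (1 - pc) ^ 2 := pow_pos (by linarith) 2
      nlinarith [mul_pos hdR h1pc]
    have hpre0 : 0 ≤ 8 * d / ((q : ℝ) * (1 - pc) ^ 2) := by positivity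
    -- `s² χ(q) ≤ M s^{2-g} ≤ M A^{2-g} n^{-θ}`
    have hs2 : s ^ 2 * (M * s ^ (-g)) = M * s ^ (2 - g) := by
      have : s ^ 2 * s ^ (-g) = s ^ (2 - g) := by
        rw [sub_eq_add_neg, Real.rpow_add hs0, Real.rpow_two]
      rw [← this]; ring
    have hsA : s ^ (2 - g) ≤ A ^ (2 - g) * (n : ℝ) ^ (-θ) := by
      have h1 : s ^ (2 - g) ≤ (A * (n : ℝ) ^ (-(1 / ν))) ^ (2 - g) :=
        Real.rpow_le_rpow hs0.le hqA (by linarith)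
      have h2 : (A * (n : ℝ) ^ (-(1 / ν))) ^ (2 - g) = A ^ (2 - g) * (n : ℝ) ^ (-θ) := by
        rw [Real.mul_rpow hA (Real.rpow_nonneg hnR.le _), ← Real.rpow_mul hnR.le]
        congr 2
        rw [hθ]; ring
      rw [← h2]; exact h1
    have herr : 8 * d / ((q : ℝ) * (1 - pc) ^ 2) * s ^ 2 * chi d q ≤ K₀ * (n : ℝ) ^ (-θ) := by
      calc 8 * d / ((q : ℝ) * (1 - pc) ^ 2) * s ^ 2 * chi d q
          ≤ 8 * d / ((q : ℝ) * (1 - pc) ^ 2) * s ^ 2 * (M * s ^ (-g)) :=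
            mul_le_mul_of_nonneg_left hχq (mul_nonneg hpre0 (sq_nonneg _))
        _ = 8 * d / ((q : ℝ) * (1 - pc) ^ 2) * (M * s ^ (2 - g)) := by rw [mul_assoc, hs2]
        _ ≤ K₁ * (M * (A ^ (2 - g) * (n : ℝ) ^ (-θ))) :=
            mul_le_mul hpre (mul_le_mul_of_nonneg_left hsA hM0.le) (by positivity) hK₁0.le
        _ = K₀ * (n : ℝ) ^ (-θ) := by rw [hK₀]; ring
    -- assemble
    have hE' : oneArmProb d (criticalProbI d) n ≤
        2 * oneArmProb d q n + 8 * d / ((q : ℝ) * (1 - pc) ^ 2) * s ^ 2 * chi d q := hE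
    calc oneArmProb d (criticalProbI d) n
        ≤ 2 * oneArmProb d q n + 8 * d / ((q : ℝ) * (1 - pc) ^ 2) * s ^ 2 * chi d q := hE'
      _ ≤ 2 * (κ * oneArmProb d (criticalProbI d) ((n + 1) / 2)) + K₀ * (n : ℝ) ^ (-θ) :=
          add_le_add (mul_le_mul_of_nonneg_left hhalf (by norm_num)) herr
      _ = 2 * κ * oneArmProb d (criticalProbI d) ((n + 1) / 2) + K₀ * (n : ℝ) ^ (-θ) := by ring
  -- THE INDUCTION
  set N₀ : ℕ := max (max n₀ n₁) 2 with hN₀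
  have hN₀2 : 2 ≤ N₀ := le_max_right _ _
  have hN₀n₀ : n₀ ≤ N₀ := (le_max_left _ _).trans (le_max_left _ _)
  have hN₀n₁ : n₁ ≤ N₀ := (le_max_right _ _).trans (le_max_left _ _)
  have hN₀R : (0 : ℝ) < N₀ := by exact_mod_cast (show 0 < N₀ by omega)
  have hgap : 0 < 1 - 2 * κ * (2 : ℝ) ^ θ := by linarith
  set C : ℝ := max ((N₀ : ℝ) ^ θ) (K₀ / (1 - 2 * κ * (2 : ℝ) ^ θ)) with hC
  have hC1 : (N₀ : ℝ) ^ θ ≤ C := le_max_left _ _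
  have hC2 : K₀ ≤ (1 - 2 * κ * (2 : ℝ) ^ θ) * C := by
    have := le_max_right ((N₀ : ℝ) ^ θ) (K₀ / (1 - 2 * κ * (2 : ℝ) ^ θ))
    rw [← hC] at this
    rwa [div_le_iff₀ hgap, mul_comm] at this
  have hC0 : 0 ≤ C := (Real.rpow_nonneg hN₀R.le θ).trans hC1
  refine ⟨C, fun n hn => ?_⟩
  rw [← hπ]
  -- strong induction on `n`
  induction n using Nat.strong_induction_on with
  | _ n ih =>
    have hnR : (0 : ℝ) < n := by exact_mod_cast hn
    by_cases hsmalln : n < N₀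
    · -- small `n`: `π ≤ 1 ≤ N₀^θ n^{-θ} ≤ C n^{-θ}`
      have h1 : (1 : ℝ) ≤ (N₀ : ℝ) ^ θ * (n : ℝ) ^ (-θ) := by
        have hle : (n : ℝ) ≤ N₀ := by exact_mod_cast hsmalln.le
        have hnθ : (n : ℝ) ^ θ ≤ (N₀ : ℝ) ^ θ := Real.rpow_le_rpow hnR.le hle hθ0.le
        have hnθ0 : 0 < (n : ℝ) ^ θ := Real.rpow_pos_of_pos hnR θ
        rw [Real.rpow_neg hnR.le, ← div_eq_mul_inv, le_div_iff₀ hnθ0, one_mul]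
        exact hnθ
      calc oneArmProb d (criticalProbI d) n ≤ 1 := by rw [hπ]; exact measureReal_le_one
        _ ≤ (N₀ : ℝ) ^ θ * (n : ℝ) ^ (-θ) := h1
        _ ≤ C * (n : ℝ) ^ (-θ) := mul_le_mul_of_nonneg_right hC1 (Real.rpow_nonneg hnR.le _)
    · push Not at hsmalln
      set m : ℕ := (n + 1) / 2 with hm
      have hm1 : 1 ≤ m := by omega
      have hmn : m < n := by omega
      have hIH := ih m hmn hm1
      have hmR : (n : ℝ) / 2 ≤ (m : ℝ) := by rw [hm]; exact half_le_cast_succ_div_two n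
      have hm0 : (0 : ℝ) < (n : ℝ) / 2 := by positivity
      -- `m^{-θ} ≤ (n/2)^{-θ} = 2^θ n^{-θ}`
      have hmθ : (m : ℝ) ^ (-θ) ≤ (2 : ℝ) ^ θ * (n : ℝ) ^ (-θ) := by
        have h1 : (m : ℝ) ^ (-θ) ≤ ((n : ℝ) / 2) ^ (-θ) :=
          Real.rpow_le_rpow_of_nonpos hm0 hmR (by linarith)
        have h2 : ((n : ℝ) / 2) ^ (-θ) = (2 : ℝ) ^ θ * (n : ℝ) ^ (-θ) := by
          rw [Real.div_rpow hnR.le (by norm_num), Real.rpow_neg (by norm_num : (0:ℝ) ≤ 2), div_inv_eq_mul, mul_comm]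
        rw [← h2]; exact h1
      have hstep := step n (hN₀n₀.trans hsmalln) (hN₀n₁.trans hsmalln) hn
      have hnθ0 : 0 ≤ (n : ℝ) ^ (-θ) := Real.rpow_nonneg hnR.le _
      calc oneArmProb d (criticalProbI d) n
          ≤ 2 * κ * oneArmProb d (criticalProbI d) m + K₀ * (n : ℝ) ^ (-θ) := hstep
        _ ≤ 2 * κ * (C * (m : ℝ) ^ (-θ)) + K₀ * (n : ℝ) ^ (-θ) := by
            have := mul_le_mul_of_nonneg_left hIH (by positivity : (0 : ℝ) ≤ 2 * κ)
            linarith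
        _ ≤ 2 * κ * (C * ((2 : ℝ) ^ θ * (n : ℝ) ^ (-θ))) + K₀ * (n : ℝ) ^ (-θ) := by
            have := mul_le_mul_of_nonneg_left (mul_le_mul_of_nonneg_left hmθ hC0) (by positivity : (0 : ℝ) ≤ 2 * κ)
            linarith
        _ = (2 * κ * (2 : ℝ) ^ θ * C + K₀) * (n : ℝ) ^ (-θ) := by ring
        _ ≤ C * (n : ℝ) ^ (-θ) := by
            apply mul_le_mul_of_nonneg_right _ hnθ0
            linarith

/-- **The mean-field row: Kozma–Nachmias's exponent `2` from EGPS's renormalisation input, in the kernel.**  Under the triangle condition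
(whence `γ = 1`: `ChiSubcritPowerBound d M 1 δ₀`, Aizenman–Newman, `chiSubcritPowerBound_one_of_triangle`) and the halving input with `ν = 1/2`
(`p_c − q ≤ A n^{−2}`) and factor `κ < 1/8`: `∃ C, OneArmPolyDecayAtCritical d 2 C`, i.e. `π_{p_c}(n) ≤ C n^{−2}`.  EGPS prove the halving input
with `κ = 1/8` for spread-out percolation in `d > 6` (enlarging their `K` gives any `κ > 0`); for the nearest-neighbour model it is open
below `d = 11` and not in the tree for any `d`.  CONDITIONAL.  [cite: KozmaNachmias2011, Thm. 1 (the bound this reproduces conditionally)]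
[cite: VanEngelenburgGarbanPanisSevero2025, Thm. 1.1 and §1.2 eq. (1.25)] [cite: DewanMuirhead2022, Thm. 1.10] -/
theorem oneArmPolyDecayAtCritical_two_of_armHalving (hd : 2 ≤ d) (hT : TriangleCondition d) {A κ : ℝ} {n₀ : ℕ}
    (hA : 0 ≤ A) (hκ : 0 ≤ κ) (hκ8 : κ < 1 / 8) (hH : NearCriticalArmHalving d A (1 / 2) κ n₀) :
    ∃ C : ℝ, OneArmPolyDecayAtCritical d 2 C := by
  obtain ⟨M, δ₀, hδ₀, hχ⟩ := chiSubcritPowerBound_one_of_triangle hd hT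
  have hexp : ((2 : ℝ) - 1) / (1 / 2) = 2 := by norm_num
  have hsmall : 2 * κ * (2 : ℝ) ^ (((2 : ℝ) - 1) / (1 / 2)) < 1 := by
    rw [hexp, Real.rpow_two]; nlinarith
  have h := oneArmPolyDecayAtCritical_of_armHalving hd (by norm_num) (by norm_num) hδ₀ hA hκ hsmall hχ hH
  rwa [hexp] at h

/-- Hence `OneArmPolyDecay d` from the two typed inputs (`g < 2`, `ν > 0`, `2κ2^θ < 1`). [cite: DewanMuirhead2022, Thm. 1.10] -/
theorem oneArmPolyDecay_of_armHalving (hd : 2 ≤ d) {M g δ₀ A ν κ : ℝ} {n₀ : ℕ}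
    (hg : g < 2) (hν : 0 < ν) (hδ₀ : 0 < δ₀) (hA : 0 ≤ A) (hκ : 0 ≤ κ)
    (hsmall : 2 * κ * (2 : ℝ) ^ ((2 - g) / ν) < 1)
    (hχ : ChiSubcritPowerBound d M g δ₀) (hH : NearCriticalArmHalving d A ν κ n₀) : OneArmPolyDecay d := by
  obtain ⟨C, hC⟩ := oneArmPolyDecayAtCritical_of_armHalving hd hg hν hδ₀ hA hκ hsmall hχ hH
  exact ⟨_, div_pos (by linarith) hν, C, hC⟩

end Summit.CriticalPhenomena.PercolationContinuityZ3.Theorems.Quant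

namespace Summit.CriticalPhenomena.PercolationContinuityZ3.Theorems.Quant

open MeasureTheory Filter Topology Literature.Probability.Percolation Literature.Probability.LatticeModels
open Literature.Barriers.CriticalPhenomena

variable {d : ℕ}

/-! ### The halving input from a Duminil-Copin–Tassion sharp-length bound -/

/-- **(C2″-input) Sharp-length bound with exponent `ν` at level `κ`:** for every `n ≥ n₀` there is a subcritical `q ∈ [p_c/2, p_c)` with
`p_c − q ≤ A n^{−1/ν}` at which Duminil-Copin–Tassion's finite-size order parameter of the half-scale box is small:
`φ_q(Λ_{⌊n/2⌋−1}) ≤ κ` (`φ_p(S) = p Σ_{x∈S, y∉S, x∼y} P_p(0 ↔ x in S)`, tree `DCT16.phi`).  Equivalently: the DCT sharp length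
`L_κ(q) = min{L : φ_q(Λ_L) ≤ κ}` is `O((p_c − q)^{−ν})`.  In print: spread-out `d > 6` with `ν = 1/2` (EGPS 2025, Cor. "bounds on ψ", from
Duminil-Copin–Panis 2025); OPEN for `3 ≤ d ≤ 6` (it is an upper bound of power type on the correlation length).  Typed, not asserted.
builds on p205010 (kernel theorem, internal audit signed; external expert review pending).
[cite: VanEngelenburgGarbanPanisSevero2025, §3 (choice of K with φ_{p'}(Λ_{(n/2)−L}) ≤ 1/8)] [cite: DuminilCopinTassionEM2016, §1 (definition of φ_p(S))] -/
@[conjecture] def SharpLengthBound (d : ℕ) (A ν κ : ℝ) (n₀ : ℕ) : Prop :=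
  ∀ n : ℕ, n₀ ≤ n → ∃ q : unitInterval, (criticalProbI d : ℝ) / 2 ≤ q ∧ (q : ℝ) < criticalProbI d ∧
    (criticalProbI d : ℝ) - q ≤ A * (n : ℝ) ^ (-(1 / ν)) ∧
    DCT16.phi q (box d (n / 2 - 1)) ≤ κ

/-- **Sharp length ⇒ halving** (the BK/exploration decomposition of Duminil-Copin–Tassion, kernel `DCT16.real_siteToBoundary_le_phi_mul`, and
monotonicity in `p`): `π_q(n) ≤ φ_q(Λ_{⌊n/2⌋−1}) · π_q(⌈n/2⌉) ≤ κ · π_{p_c}(⌈n/2⌉)`.  Hence `SharpLengthBound d A ν κ n₀ ⟹ NearCriticalArmHalving d A ν κ n₀`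
for `n₀ ≥ 2`. [cite: DuminilCopinTassionEM2016, §2.1 (P_p[0 ↔ ∂Λ_{kL}] ≤ φ_p(S) P_p[0 ↔ ∂Λ_{(k−1)L}])] [cite: VanEngelenburgGarbanPanisSevero2025, §3 (θ_n(p') ≤ φ_{p'}(Λ_{n/2−L}) θ_{n/2}(p_c))] -/
theorem nearCriticalArmHalving_of_sharpLengthBound {A ν κ : ℝ} {n₀ : ℕ} (hn₀ : 2 ≤ n₀)
    (h : SharpLengthBound d A ν κ n₀) : NearCriticalArmHalving d A ν κ n₀ := by
  intro n hn
  obtain ⟨q, hq1, hq2, hqA, hφ⟩ := h n hn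
  refine ⟨q, hq1, hq2, hqA, ?_⟩
  have hn2 : 2 ≤ n := hn₀.trans hn
  set L : ℕ := n / 2 - 1 with hL
  set m : ℕ := (n + 1) / 2 with hm
  have hmL : m + L + 1 = n := by omega
  have hstep := DCT16.real_siteToBoundary_le_phi_mul q (zero_mem_box d L) (subset_refl _) m
  rw [hmL] at hstep
  have hmono : (bondPercolation (zdGraph d) q).real (siteToBoundary d m) ≤
      (bondPercolation (zdGraph d) (criticalProbI d)).real (siteToBoundary d m) :=
    DCT16.real_mono_of_isUpperSet (zdGraph d) (DCT16.isUpperSet_siteToBoundary d m)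
      (DCT16.measurableSet_siteToBoundary d m) (Subtype.coe_le_coe.1 hq2.le)
  have hφ0 : 0 ≤ DCT16.phi q (box d L) := DCT16.phi_nonneg q _
  calc oneArmProb d q n
      ≤ DCT16.phi q (box d L) * (bondPercolation (zdGraph d) q).real (siteToBoundary d m) := hstep
    _ ≤ κ * (bondPercolation (zdGraph d) (criticalProbI d)).real (siteToBoundary d m) :=
        mul_le_mul hφ hmono measureReal_nonneg (hφ0.trans hφ)
    _ = κ * oneArmProb d (criticalProbI d) ((n + 1) / 2) := rfl

/-- **Sharp length + subcritical susceptibility ⇒ the sharp exponent `(2−g)/ν`.** [cite: DewanMuirhead2022, Thm. 1.10]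
[cite: VanEngelenburgGarbanPanisSevero2025, Thm. 1.1 and §3] -/
theorem oneArmPolyDecayAtCritical_of_sharpLengthBound (hd : 2 ≤ d) {M g δ₀ A ν κ : ℝ} {n₀ : ℕ} (hn₀ : 2 ≤ n₀)
    (hg : g < 2) (hν : 0 < ν) (hδ₀ : 0 < δ₀) (hA : 0 ≤ A) (hκ : 0 ≤ κ)
    (hsmall : 2 * κ * (2 : ℝ) ^ ((2 - g) / ν) < 1)
    (hχ : ChiSubcritPowerBound d M g δ₀) (hL : SharpLengthBound d A ν κ n₀) :
    ∃ C : ℝ, OneArmPolyDecayAtCritical d ((2 - g) / ν) C :=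
  oneArmPolyDecayAtCritical_of_armHalving hd hg hν hδ₀ hA hκ hsmall hχ (nearCriticalArmHalving_of_sharpLengthBound hn₀ hL)

/-- **Mean-field row from the sharp length**: `TriangleCondition d` + `SharpLengthBound d A (1/2) κ n₀` (`κ < 1/8`, `n₀ ≥ 2`) ⟹ `∃ C, OneArmPolyDecayAtCritical d 2 C` —
EGPS's Theorem 1.1 (upper bound) as a kernel implication from its two inputs, the sharp-length bound and the triangle condition (both theorems for spread-out `d > 6`,
Duminil-Copin–Panis 2025; hypotheses here). [cite: VanEngelenburgGarbanPanisSevero2025, Thm. 1.1] [cite: KozmaNachmias2011, Thm. 1] -/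
theorem oneArmPolyDecayAtCritical_two_of_sharpLengthBound (hd : 2 ≤ d) (hT : TriangleCondition d) {A κ : ℝ} {n₀ : ℕ} (hn₀ : 2 ≤ n₀)
    (hA : 0 ≤ A) (hκ : 0 ≤ κ) (hκ8 : κ < 1 / 8) (hL : SharpLengthBound d A (1 / 2) κ n₀) :
    ∃ C : ℝ, OneArmPolyDecayAtCritical d 2 C :=
  oneArmPolyDecayAtCritical_two_of_armHalving hd hT hA hκ hκ8 (nearCriticalArmHalving_of_sharpLengthBound hn₀ hL)

end Summit.CriticalPhenomena.PercolationContinuityZ3.Theorems.Quant
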